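import Literature.AlgebraicGeometry.Frobenioids.GeometricFrobenioidStandard
import Literature.AlgebraicGeometry.Frobenioids.GeometricDivisorDataWitness
import Mathlib.FieldTheory.IsAlgClosed.AlgebraicClosure
import Mathlib.FieldTheory.IsSepClosed
import Mathlib.FieldTheory.RatFunc.AsPolynomial
import HarnessLib

/-!
# Frobenioids I, §6 sub-DAG rows T62ii/L03, T62ii/L04, T62ii/L06, T62iii/L06 (`Thm62_geomHypotheses`,
# `Thm62_geomIsFrobenioid`, `Thm62ii_unconditional`, `Thm62iii_L06_standard`) HEAD-MATCHED AT DATA — PROOF-ONLY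

Mochizuki, *The geometry of Frobenioids I: the general theory*, Kyushu J. Math. **62** (2008) 293–400, §6:
Example 6.1 p. 109 and Theorem 6.2 pp. 110–112 ("For `i = 1, 2`, let `V_i` be a proper normal [geometrically
integral] variety over a field `k_i`, `K_i` the function field of `V_i`, `K̃_i/K_i` a [possibly infinite] Galois
extension, … `C_i` for the associated model Frobenioid of Theorem 5.2, (ii)"; (ii): "let us suppose that `k` is of
positive characteristic `p`. Then the Frobenius morphism `ψ : V → V` satisfies the conditions of (i), hence determines
a functor `Ψ : C → C` which is isomorphic to the naive Frobenius functor [of degree `p` on `C`] of Proposition 2.1";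
(iii): "the Frobenioid `C` is of isotropic, standard and birationally Frobenius-normalized type, but not of group-like
type") [cite: MochizukiFrdI2008, Ex. 6.1 p.109] [cite: MochizukiFrdI2008, Thm. 6.2 p.110]
[cite: MochizukiFrdI2008, Thm. 6.2 (ii) p.111] [cite: MochizukiFrdI2008, Thm. 6.2 (iii) p.112]
(quoted from the kurims text; the journal printing, doi:10.2206/kyushujm.62.293 pp. 389–393, has the same words with
parentheses in place of the square brackets).

PROOF-ONLY companion (cell abc-iut, block F, seat abc-iut-f-001, KEY INST59K1; FROZEN FACT-LIST rows F-1133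
`Thm62_geomHypotheses`, F-1134 `Thm62_geomIsFrobenioid`, F-1135 `Thm62ii_unconditional`, F-1137
`Thm62iii_L06_standard` of abc-iut-L1-t1's `MotivatingExamplesSub.lean`; 0 `def`, 0 `instance`, 0 `structure`, no
notation, nothing restated; the declaring file is imported — through abc-iut-L6-t10's `GeometricFrobenioidStandard.lean`
— never edited).

WHAT THE KERNEL RECORDS.  The four rows are predicates of an interface datum `Γ : GeometricDivisorData K K̃` (abc-iut-L1-t3,
v4) over free fields `K ⊆ K̃`.  Their universal closures are FALSE as typed (abc-iut-f-043:
`not_forall_Thm62_geomHypotheses`, `not_forall_Thm62_geomIsFrobenioid`, `not_forall_Thm62ii_unconditional`,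
`not_forall_Thm62iii_L06_standard` — the base `D = B(G)⁰` must be of FSM-type, which print has because `K̃/K` is Galois),
and the closers of record (`Thm62_geomHypotheses_holds`, `Thm62_geomIsFrobenioid_holds`, `Thm62ii_unconditional_holds`,
`Thm62iii_L06_standard_holds`, abc-iut-L6-t10) are universal under the printed binder `[IsGalois K K̃]`, so no theorem
of the tree had one of the four predicates as conclusion HEAD at concrete data.  This file supplies such instance forms:

* GENUINE BASE DATA: `K = ℚ(t)` (`RatFunc ℚ`, the function field of the projective line over `k = ℚ` — a proper normal
  geometrically integral variety over a field) with `K̃ =` an algebraic closure of `K` (`AlgebraicClosure (RatFunc ℚ)`,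
  Galois over `K` in characteristic `0`); for row (ii), which lives in characteristic `p`, `K = 𝔽_p(t)`
  (`RatFunc (ZMod p)`, the function field of the projective line over `k = 𝔽_p`) with `K̃ =` the separable closure of
  `K` in an algebraic closure (`separableClosure K K̄`, Galois over `K`) and with `K̃ = K` (the trivial Galois
  extension, allowed by print's "[possibly infinite] Galois extension"), for EVERY prime `p` and at `p = 2`;
* TOY DIVISOR CARRIER, LABELLED AS SUCH: proper normal varieties, normalisations and Cartier divisors are not in
  Mathlib, so the divisor datum is the tree's inhabitant `GeometricDivisorData.trivial K K̃`
  (`GeometricDivisorDataWitness.lean`: ONE prime divisor over every `Spec L`, `Φ(L) = ℤ_{≥0}·pt` — saturated and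
  `ℚ`-Cartier —, `B(L) = 1`, `div = 0`, primes below = identity, ramification indices `1`).  It is NOT the divisor
  data of `P¹` (whose `B(L) ⊇ k_L^×`); an instance form at it certifies that the typed predicates are satisfiable at
  honest field data and exercises the closers of record, nothing more;
* and, for each row, the instance at the toy carrier over EVERY Galois pair `K ⊆ K̃` (print's binder).

An instance-form theorem about OUR typed statement ≠ a theorem about [FrdI] in print; classical, undisputed mathematics;
nothing here bears on [IUTchIII] Cor. 3.12 or asserts anything about abc; typed ≠ proved for anything not in this file.
-/

namespace Literature.AlgebraicGeometry.Frobenioids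

/-! ### Row T62ii/L03 — F-1133 `Thm62_geomHypotheses` (the hypotheses of Thm. 5.2 for the data of Ex. 6.1) -/

/-- **F-1133 at `K = ℚ(t) ⊂ K̃ = K̄`, toy divisor carrier**: the hypotheses of Thm. 5.2 ("`Φ` … a perf-factorial
divisorial monoid on `D`", "`B` … a group-like monoid on `D`", `D = B(G)⁰` connected and totally epimorphic, Ex. 6.1
p. 109) HOLD for the datum `GeometricDivisorData.trivial ℚ(t) K̄` over the base `D = B(Gal(K̄/ℚ(t)))⁰` — INSTANCE at the
toy carrier (one prime divisor, `Φ(L) = ℤ_{≥0}`, `B(L) = 1`) over genuine field data; by abc-iut-L6-t10's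
`Thm62_geomHypotheses_holds`. [cite: MochizukiFrdI2008, Ex. 6.1 p.109] -/
theorem Thm62_geomHypotheses_trivial_ratFunc_rat :
    Thm62_geomHypotheses (GeometricDivisorData.trivial (RatFunc ℚ) (AlgebraicClosure (RatFunc ℚ))) :=
  Thm62_geomHypotheses_holds _

/-- **F-1133 at the toy carrier over EVERY Galois pair `K ⊆ K̃`** (print's "`K̃_i/K_i` a [possibly infinite] Galois
extension"): the hypotheses of Thm. 5.2 hold for `GeometricDivisorData.trivial K K̃`.
[cite: MochizukiFrdI2008, Ex. 6.1 p.109] -/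
theorem Thm62_geomHypotheses_trivial (K : Type) [Field K] (Kt : Type) [Field Kt] [Algebra K Kt] [IsGalois K Kt] :
    Thm62_geomHypotheses (GeometricDivisorData.trivial K Kt) :=
  Thm62_geomHypotheses_holds _

/-! ### Row T62ii/L04 — F-1134 `Thm62_geomIsFrobenioid` ("`C_i` … the associated model Frobenioid of Theorem 5.2, (ii)") -/

/-- **F-1134 at `K = ℚ(t) ⊂ K̃ = K̄`, toy divisor carrier**: the functor `C_{K̄/ℚ(t)} → F_Φ` of the constructed
geometric model of the datum `GeometricDivisorData.trivial ℚ(t) K̄` IS a Frobenioid (Def. 1.3) — INSTANCE at the toy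
carrier over genuine field data; by abc-iut-L6-t10's `Thm62_geomIsFrobenioid_holds` (Thm. 5.2 (ii)).
[cite: MochizukiFrdI2008, Thm. 6.2 p.110] -/
theorem Thm62_geomIsFrobenioid_trivial_ratFunc_rat :
    Thm62_geomIsFrobenioid (GeometricDivisorData.trivial (RatFunc ℚ) (AlgebraicClosure (RatFunc ℚ))) :=
  Thm62_geomIsFrobenioid_holds _

/-- **F-1134 at the toy carrier over EVERY Galois pair `K ⊆ K̃`**: `C_{K̃/K} → F_Φ` of
`GeometricDivisorData.trivial K K̃` is a Frobenioid. [cite: MochizukiFrdI2008, Thm. 6.2 p.110] -/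
theorem Thm62_geomIsFrobenioid_trivial (K : Type) [Field K] (Kt : Type) [Field Kt] [Algebra K Kt]
    [IsGalois K Kt] : Thm62_geomIsFrobenioid (GeometricDivisorData.trivial K Kt) :=
  Thm62_geomIsFrobenioid_holds _

/-! ### Row T62ii/L06 — F-1135 `Thm62ii_unconditional` (Thm. 6.2 (ii), positive characteristic) -/

/-- **F-1135 at `K = K̃ = 𝔽_p(t)` for EVERY prime `p`, toy divisor carrier**: in characteristic `p` ("let us suppose
that `k` is of positive characteristic `p`"), for the datum `GeometricDivisorData.trivial 𝔽_p(t) 𝔽_p(t)` over the base of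
the trivial Galois extension `K̃ = K = 𝔽_p(t)` (the function field of the projective line over `𝔽_p`), `C` IS a
Frobenioid AND the Frobenius pull-back functor is isomorphic to the naive Frobenius functor of degree `p` — INSTANCE at
the toy carrier over genuine field data; by abc-iut-L6-t10's `Thm62ii_unconditional_holds`.
[cite: MochizukiFrdI2008, Thm. 6.2 (ii) p.111] -/
theorem Thm62ii_unconditional_trivial_ratFunc_zmod (p : ℕ) [Fact p.Prime] :
    Thm62ii_unconditional (GeometricDivisorData.trivial (RatFunc (ZMod p)) (RatFunc (ZMod p))) p :=
  Thm62ii_unconditional_holds _ p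

/-- **F-1135 at `K = 𝔽_p(t) ⊂ K̃ = K^sep` for EVERY prime `p`, toy divisor carrier**: the same with `K̃` the
separable closure of `𝔽_p(t)` inside an algebraic closure (a genuinely infinite Galois extension,
`G = Gal(K^sep/𝔽_p(t))` the absolute Galois group). [cite: MochizukiFrdI2008, Thm. 6.2 (ii) p.111] -/
theorem Thm62ii_unconditional_trivial_ratFunc_zmod_sepClosure (p : ℕ) [Fact p.Prime] :
    Thm62ii_unconditional (GeometricDivisorData.trivial (RatFunc (ZMod p))
      (separableClosure (RatFunc (ZMod p)) (AlgebraicClosure (RatFunc (ZMod p))))) p :=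
  Thm62ii_unconditional_holds _ p

/-- **F-1135 at `p = 2`, `K = K̃ = 𝔽₂(t)`, toy divisor carrier** — every binder closed.
[cite: MochizukiFrdI2008, Thm. 6.2 (ii) p.111] -/
theorem Thm62ii_unconditional_trivial_ratFunc_zmod_two :
    Thm62ii_unconditional (GeometricDivisorData.trivial (RatFunc (ZMod 2)) (RatFunc (ZMod 2))) 2 :=
  Thm62ii_unconditional_holds _ 2

/-- **F-1135 at the toy carrier over EVERY Galois pair `K ⊆ K̃` with `char K = p`**.
[cite: MochizukiFrdI2008, Thm. 6.2 (ii) p.111] -/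
theorem Thm62ii_unconditional_trivial (K : Type) [Field K] (Kt : Type) [Field Kt] [Algebra K Kt] [IsGalois K Kt]
    (p : ℕ) [Fact p.Prime] [CharP K p] : Thm62ii_unconditional (GeometricDivisorData.trivial K Kt) p :=
  Thm62ii_unconditional_holds _ p

/-! ### Row T62iii/L06 — F-1137 `Thm62iii_L06_standard` ("hence that `C` is of standard type", Thm. 6.2 (iii)) -/

/-- **F-1137 at `K = ℚ(t) ⊂ K̃ = K̄`, toy divisor carrier**: the operations of `C_{K̄/ℚ(t)}` built from
`GeometricDivisorData.trivial ℚ(t) K̄` are of standard type (Def. 4.5 (ii)) — INSTANCE at the toy carrier over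
genuine field data; by abc-iut-L6-t10's `Thm62iii_L06_standard_holds`. [cite: MochizukiFrdI2008, Thm. 6.2 (iii) p.112] -/
theorem Thm62iii_L06_standard_trivial_ratFunc_rat :
    Thm62iii_L06_standard (GeometricDivisorData.trivial (RatFunc ℚ) (AlgebraicClosure (RatFunc ℚ))) :=
  Thm62iii_L06_standard_holds _

/-- **F-1137 at the toy carrier over EVERY Galois pair `K ⊆ K̃`**: standard type for
`GeometricDivisorData.trivial K K̃`. [cite: MochizukiFrdI2008, Thm. 6.2 (iii) p.112] -/
theorem Thm62iii_L06_standard_trivial (K : Type) [Field K] (Kt : Type) [Field Kt] [Algebra K Kt]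
    [IsGalois K Kt] : Thm62iii_L06_standard (GeometricDivisorData.trivial K Kt) :=
  Thm62iii_L06_standard_holds _

end Literature.AlgebraicGeometry.Frobenioids
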